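import Mathlib
import HarnessLib

/-!
# Aitken's Δ² process, Wynn's ε-array and Richardson extrapolation (Davis–Rabinowitz 1984, Sect. 1.15)

Davis–Rabinowitz, *Methods of Numerical Integration* (2nd ed., 1984), Sect. 1.15 "Extrapolation and speed-up":

* Aitken's Δ² transformation `s'_n = (s_n s_{n+2} - s_{n+1}²)/(s_{n+2} - 2 s_{n+1} + s_n) = s_{n+2} - (Δ s_{n+1})²/Δ² s_n`
  (1.15.2); it is EXACT on the linear-convergence model `s = s_n + c qⁿ` (1.15.1 with `ε_n ≡ 0`; Shanks' model (1.15.4)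
  with `p = 1`), and under (1.15.1) `s = s_n + (c + ε_n) qⁿ`, `c ≠ 0`, `ε_n → 0`, it ACCELERATES convergence:
  `(s - s'_n)/(s - s_n) → 0` (1.15.3);
* Wynn's ε-algorithm `ε_{-1}^{(j)} = 0`, `ε_0^{(j)} = s_j`, `ε_{k+1}^{(j)} = ε_{k-1}^{(j+1)} + (ε_k^{(j+1)} - ε_k^{(j)})^{-1}`,
  whose column `ε_2` is Aitken's transformation;
* Richardson's "deferred approach to the limit" `s* = (σ^α s_{σn} - s_n)/(σ^α - 1)` (1.15.9)–(1.15.10), exact on the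
  model `s = s_n + c n^{-α}` (1.15.7a).

Recorded as closed-form algebra plus one limit theorem.  Cross-references (nothing restated): the Romberg T-table for the
trapezoidal rule (`Literature.Analysis.Quadrature.RombergTable`, (6.3.x)) is the instance `α = 2, 4, …` of (1.15.11);
the `ZeroNoiseExtrapolation` anchors (quantum error mitigation) and `Literature.Analysis.Matrix.RichardsonIteration`
use Richardson's name for different objects.

Provenance: engines group, shared numerical engines serving client cells; rigour lives in the verifiers; every
published number belongs to a client cell's ledger, not to the engines group.  Textbook facts only (no client
numbers).
-/

namespace Literature.Analysis.Quadrature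

open Filter Topology

noncomputable section

/-! ### Aitken's Δ² transformation (1.15.2) -/

/-- Aitken's Δ² transformation `s'_n = (s_n s_{n+2} - s_{n+1}²)/(s_{n+2} - 2 s_{n+1} + s_n)`.
[cite: DavisRabinowitz1984, Sect. 1.15 (1.15.2)] -/
def aitken (s : ℕ → ℝ) (n : ℕ) : ℝ :=
  (s n * s (n + 2) - s (n + 1) ^ 2) / (s (n + 2) - 2 * s (n + 1) + s n)

/-- The second form of (1.15.2): `s'_n = s_{n+2} - (Δ s_{n+1})² / Δ² s_n` (when `Δ² s_n ≠ 0`).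
[cite: DavisRabinowitz1984, Sect. 1.15 (1.15.2)] -/
theorem aitken_eq_sub_sq_div (s : ℕ → ℝ) (n : ℕ) (h : s (n + 2) - 2 * s (n + 1) + s n ≠ 0) :
    aitken s n = s (n + 2) - (s (n + 2) - s (n + 1)) ^ 2 / (s (n + 2) - 2 * s (n + 1) + s n) := by
  unfold aitken
  obtain ⟨a, ha⟩ : ∃ a, s n = a := ⟨_, rfl⟩
  obtain ⟨b, hb⟩ : ∃ b, s (n + 1) = b := ⟨_, rfl⟩
  obtain ⟨d, hd⟩ : ∃ d, s (n + 2) = d := ⟨_, rfl⟩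
  rw [ha, hb, hd] at h ⊢
  rw [sub_div' h, div_eq_div_iff h h]
  ring

/-- Aitken's transformation is translation-equivariant: shifting the sequence by `a` shifts `s'` by `a`
(when `Δ² s_n ≠ 0`). [cite: DavisRabinowitz1984, Sect. 1.15 (1.15.2)] -/
theorem aitken_add_const (s : ℕ → ℝ) (a : ℝ) (n : ℕ) (h : s (n + 2) - 2 * s (n + 1) + s n ≠ 0) :
    aitken (fun k => s k + a) n = aitken s n + a := by
  unfold aitken
  obtain ⟨x, hx⟩ : ∃ x, s n = x := ⟨_, rfl⟩
  obtain ⟨y, hy⟩ : ∃ y, s (n + 1) = y := ⟨_, rfl⟩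
  obtain ⟨z, hz⟩ : ∃ z, s (n + 2) = z := ⟨_, rfl⟩
  simp only [hx, hy, hz] at h ⊢
  have h' : z + a - 2 * (y + a) + (x + a) ≠ 0 := by
    intro h''; apply h; linarith
  rw [div_add' _ _ _ h, div_eq_div_iff h' h]
  ring

/-- **Exactness on the linear-convergence model** (1.15.1) with `ε_n ≡ 0` (Shanks' model (1.15.4) with `p = 1`):
if `s_n = s - c qⁿ` with `c ≠ 0`, `q ≠ 0`, `q ≠ 1`, then `s'_n = s` for every `n`.
[cite: DavisRabinowitz1984, Sect. 1.15 (1.15.1)] -/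
theorem aitken_geometric {s : ℕ → ℝ} {S c q : ℝ} (hc : c ≠ 0) (hq0 : q ≠ 0) (hq1 : q ≠ 1)
    (hs : ∀ n, s n = S - c * q ^ n) (n : ℕ) : aitken s n = S := by
  unfold aitken
  have hden : s (n + 2) - 2 * s (n + 1) + s n ≠ 0 := by
    rw [hs, hs, hs]
    have : S - c * q ^ (n + 2) - 2 * (S - c * q ^ (n + 1)) + (S - c * q ^ n) = -(c * q ^ n * (q - 1) ^ 2) := by
      ring
    rw [this, neg_ne_zero]
    exact mul_ne_zero (mul_ne_zero hc (pow_ne_zero _ hq0)) (pow_ne_zero _ (sub_ne_zero.2 hq1))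
  rw [div_eq_iff hden, hs, hs, hs]
  ring

/-- **Error identity.** With `e_k = s - s_k`: `s - s'_n = (e_n e_{n+2} - e_{n+1}²) / Δ² e_n` (when `Δ² e_n ≠ 0`).
[cite: DavisRabinowitz1984, Sect. 1.15 (1.15.2)] -/
theorem sub_aitken_eq (s : ℕ → ℝ) (S : ℝ) (n : ℕ)
    (h : (S - s (n + 2)) - 2 * (S - s (n + 1)) + (S - s n) ≠ 0) :
    S - aitken s n = ((S - s n) * (S - s (n + 2)) - (S - s (n + 1)) ^ 2) /
      ((S - s (n + 2)) - 2 * (S - s (n + 1)) + (S - s n)) := by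
  unfold aitken
  obtain ⟨a, ha⟩ : ∃ a, s n = a := ⟨_, rfl⟩
  obtain ⟨b, hb⟩ : ∃ b, s (n + 1) = b := ⟨_, rfl⟩
  obtain ⟨d, hd⟩ : ∃ d, s (n + 2) = d := ⟨_, rfl⟩
  rw [ha, hb, hd] at h ⊢
  have h' : d - 2 * b + a ≠ 0 := by
    intro h''; apply h; linarith
  rw [sub_div' h', div_eq_div_iff h' h]
  ring

/-- **Aitken's process accelerates linear convergence** (1.15.3): if `s - s_n = (c + ε_n) qⁿ` with `c ≠ 0`,
`q ≠ 0`, `q ≠ 1` and `ε_n → 0`, then `(s - s'_n)/(s - s_n) → 0`.  (The text assumes `|q| < 1`, which makes `s_n → s`;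
the ratio statement itself does not need it.) [cite: DavisRabinowitz1984, Sect. 1.15 (1.15.3)] -/
theorem aitken_accelerates {s ε : ℕ → ℝ} {S c q : ℝ} (hc : c ≠ 0) (hq0 : q ≠ 0) (hq1 : q ≠ 1)
    (hs : ∀ n, S - s n = (c + ε n) * q ^ n) (hε : Tendsto ε atTop (𝓝 0)) :
    Tendsto (fun n => (S - aitken s n) / (S - s n)) atTop (𝓝 0) := by
  -- `E n = c + ε n → c`, `D n = E(n+2) q² - 2 E(n+1) q + E n → c (q-1)²`, `δ n = E n E(n+2) - E(n+1)² → 0`.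
  set E : ℕ → ℝ := fun n => c + ε n with hE_def
  have hE : Tendsto E atTop (𝓝 c) := by simpa [hE_def] using tendsto_const_nhds.add hε
  have hE1 : Tendsto (fun n => E (n + 1)) atTop (𝓝 c) := hE.comp (tendsto_add_atTop_nat 1)
  have hE2 : Tendsto (fun n => E (n + 2)) atTop (𝓝 c) := hE.comp (tendsto_add_atTop_nat 2)
  have hD : Tendsto (fun n => E (n + 2) * q ^ 2 - 2 * E (n + 1) * q + E n) atTop (𝓝 (c * q ^ 2 - 2 * c * q + c)) :=
    ((hE2.mul_const _).sub (hE1.const_mul 2 |>.mul_const q)).add hE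
  have hδ : Tendsto (fun n => E n * E (n + 2) - E (n + 1) ^ 2) atTop (𝓝 0) := by
    have := (hE.mul hE2).sub (hE1.pow 2)
    simpa [sq] using this
  have hcq : c * q ^ 2 - 2 * c * q + c ≠ 0 := by
    have : c * q ^ 2 - 2 * c * q + c = c * (q - 1) ^ 2 := by ring
    rw [this]; exact mul_ne_zero hc (pow_ne_zero _ (sub_ne_zero.2 hq1))
  have hlim : Tendsto (fun n => q ^ 2 * (E n * E (n + 2) - E (n + 1) ^ 2) /
      ((E (n + 2) * q ^ 2 - 2 * E (n + 1) * q + E n) * E n)) atTop (𝓝 0) := by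
    have := (hδ.const_mul (q ^ 2)).div (hD.mul hE) (mul_ne_zero hcq hc)
    rw [mul_zero, zero_div] at this
    exact this
  refine hlim.congr' ?_
  filter_upwards [hD.eventually_ne hcq, hE.eventually_ne hc] with n hDn hEn
  have he : ∀ k, S - s k = E k * q ^ k := fun k => hs k
  have hqn : q ^ n ≠ 0 := pow_ne_zero _ hq0
  have hΔ' : E (n + 2) * q ^ (n + 2) - 2 * (E (n + 1) * q ^ (n + 1)) + E n * q ^ n ≠ 0 := by
    have : E (n + 2) * q ^ (n + 2) - 2 * (E (n + 1) * q ^ (n + 1)) + E n * q ^ n =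
        q ^ n * (E (n + 2) * q ^ 2 - 2 * E (n + 1) * q + E n) := by ring
    rw [this]
    exact mul_ne_zero hqn hDn
  have hΔ : (S - s (n + 2)) - 2 * (S - s (n + 1)) + (S - s n) ≠ 0 := by
    rw [he, he, he]; exact hΔ'
  rw [sub_aitken_eq s S n hΔ, he, he, he, div_div,
    div_eq_div_iff (mul_ne_zero hDn hEn) (mul_ne_zero hΔ' (mul_ne_zero hEn hqn))]
  ring

/-! ### Wynn's ε-algorithm (Sect. 1.15, after (1.15.4)) -/

/-- Wynn's ε-array, indexed so that `wynn s k j = ε_{k-1}^{(j)}`: `wynn s 0 j = ε_{-1}^{(j)} = 0`,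
`wynn s 1 j = ε_0^{(j)} = s_j`, `wynn s (k+2) j = wynn s k (j+1) + (wynn s (k+1) (j+1) - wynn s (k+1) j)⁻¹`.
[cite: DavisRabinowitz1984, Sect. 1.15 (1.15.4)] -/
def wynn (s : ℕ → ℝ) : ℕ → ℕ → ℝ
  | 0, _ => 0
  | 1, j => s j
  | k + 2, j => wynn s k (j + 1) + (wynn s (k + 1) (j + 1) - wynn s (k + 1) j)⁻¹

/-- `ε_{-1}^{(j)} = 0`, `ε_0^{(j)} = s_j`. [cite: DavisRabinowitz1984, Sect. 1.15 (1.15.4)] -/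
theorem wynn_zero_one (s : ℕ → ℝ) (j : ℕ) : wynn s 0 j = 0 ∧ wynn s 1 j = s j := by
  simp [wynn]

/-- `ε_1^{(j)} = 1/(s_{j+1} - s_j)`. [cite: DavisRabinowitz1984, Sect. 1.15 (1.15.4)] -/
theorem wynn_two (s : ℕ → ℝ) (j : ℕ) : wynn s 2 j = (s (j + 1) - s j)⁻¹ := by
  simp [wynn]

/-- **The column `ε_2` of Wynn's array is Aitken's Δ² transformation**: `ε_2^{(j)} = s'_j`
(when the differences involved are nonzero). [cite: DavisRabinowitz1984, Sect. 1.15 (1.15.4)] -/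
theorem wynn_three_eq_aitken (s : ℕ → ℝ) (j : ℕ) (h1 : s (j + 1) - s j ≠ 0) (h2 : s (j + 2) - s (j + 1) ≠ 0)
    (h3 : s (j + 2) - 2 * s (j + 1) + s j ≠ 0) : wynn s 3 j = aitken s j := by
  have hw : wynn s 3 j = s (j + 1) + ((s (j + 2) - s (j + 1))⁻¹ - (s (j + 1) - s j)⁻¹)⁻¹ := by
    simp only [wynn, zero_add]
  rw [hw, inv_sub_inv h2 h1, inv_div]
  unfold aitken
  obtain ⟨a, ha⟩ : ∃ a, s j = a := ⟨_, rfl⟩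
  obtain ⟨b, hb⟩ : ∃ b, s (j + 1) = b := ⟨_, rfl⟩
  obtain ⟨d, hd⟩ : ∃ d, s (j + 2) = d := ⟨_, rfl⟩
  simp only [ha, hb, hd] at h1 h2 h3 ⊢
  have h5 : (b - a) - (d - b) ≠ 0 := by
    intro h; apply h3; linarith
  rw [add_div' _ _ _ h5, div_eq_div_iff h5 h3]
  ring

/-- Consequently `ε_2^{(j)} = s` on the model `s_j = s - c qʲ` (`p = 1` in (1.15.4)).
[cite: DavisRabinowitz1984, Sect. 1.15 (1.15.4)] -/
theorem wynn_three_geometric {s : ℕ → ℝ} {S c q : ℝ} (hc : c ≠ 0) (hq0 : q ≠ 0) (hq1 : q ≠ 1)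
    (hs : ∀ n, s n = S - c * q ^ n) (j : ℕ) : wynn s 3 j = S := by
  have hcq : ∀ m : ℕ, c * q ^ m * (q - 1) ≠ 0 := fun m =>
    mul_ne_zero (mul_ne_zero hc (pow_ne_zero _ hq0)) (sub_ne_zero.2 hq1)
  rw [wynn_three_eq_aitken s j ?_ ?_ ?_, aitken_geometric hc hq0 hq1 hs]
  · rw [hs, hs, show S - c * q ^ (j + 1) - (S - c * q ^ j) = -(c * q ^ j * (q - 1)) by ring, neg_ne_zero]
    exact hcq j
  · rw [hs, hs, show S - c * q ^ (j + 2) - (S - c * q ^ (j + 1)) = -(c * q ^ (j + 1) * (q - 1)) by ring, neg_ne_zero]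
    exact hcq (j + 1)
  · rw [hs, hs, hs, show S - c * q ^ (j + 2) - 2 * (S - c * q ^ (j + 1)) + (S - c * q ^ j) =
      -(c * q ^ j * (q - 1) * (q - 1)) by ring, neg_ne_zero]
    exact mul_ne_zero (hcq j) (sub_ne_zero.2 hq1)

/-! ### Richardson extrapolation (1.15.9)–(1.15.10) -/

/-- Richardson's extrapolated value `s* = (σ^α s_{σn} - s_n)/(σ^α - 1)` from the pair `s_n, s_{σn}`.
[cite: DavisRabinowitz1984, Sect. 1.15 (1.15.9)] -/
def richardsonStep (σ : ℕ) (α : ℝ) (s : ℕ → ℝ) (n : ℕ) : ℝ :=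
  ((σ : ℝ) ^ α * s (σ * n) - s n) / ((σ : ℝ) ^ α - 1)

/-- **Exactness of Richardson extrapolation on the model `s = s_n + c n^{-α}`** (1.15.7a): for `σ ≥ 2`, `α > 0`
and `n ≥ 1`, `s* = s`. [cite: DavisRabinowitz1984, Sect. 1.15 (1.15.9)] -/
theorem richardsonStep_exact {σ : ℕ} (hσ : 2 ≤ σ) {α : ℝ} (hα : 0 < α) {s : ℕ → ℝ} {S c : ℝ}
    (hs : ∀ n, 1 ≤ n → s n = S - c * ((n : ℝ) ^ α)⁻¹) {n : ℕ} (hn : 1 ≤ n) :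
    richardsonStep σ α s n = S := by
  unfold richardsonStep
  have hσ1 : (1 : ℝ) < (σ : ℝ) ^ α := Real.one_lt_rpow (by exact_mod_cast hσ) hα
  have hσpos : (0 : ℝ) < σ := by exact_mod_cast (zero_lt_two.trans_le hσ)
  have hnpos : (0 : ℝ) < n := by exact_mod_cast hn
  rw [div_eq_iff (sub_ne_zero.2 hσ1.ne'), hs n hn, hs (σ * n) (le_trans hn (Nat.le_mul_of_pos_left n (by omega))),
    Nat.cast_mul, Real.mul_rpow hσpos.le hnpos.le]
  have h1 : ((σ : ℝ) ^ α) ≠ 0 := (zero_lt_one.trans hσ1).ne'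
  have h2 : ((n : ℝ) ^ α) ≠ 0 := (Real.rpow_pos_of_pos hnpos α).ne'
  field_simp
  ring

/-- The common case `σ = 2` (1.15.10): `s* = (2^α s_{2n} - s_n)/(2^α - 1)`; for the trapezoidal rule `α = 2` gives
`(4 s_{2n} - s_n)/3`. [cite: DavisRabinowitz1984, Sect. 1.15 (1.15.10)] -/
theorem richardsonStep_two_two (s : ℕ → ℝ) (n : ℕ) : richardsonStep 2 2 s n = (4 * s (2 * n) - s n) / 3 := by
  unfold richardsonStep
  norm_num

end

end Literature.Analysis.Quadrature
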